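import Mathlib
import HarnessLib
import HarnessLib.Audit
import Summits.PneNP.Statement
import Literature.Computability.MetaComplexity.Frege
import Literature.Computability.Complexity.Classes
import Literature.Computability.Complexity.CNF
import Literature.Computability.Complexity.CookBridges
import Literature.Computability.Complexity.SearchToDecision
import Summits.PneNP.PneNP.Theorems.EfNotPOptimalEFProofSearchOfCollapse
import Literature.Computability.MetaComplexity.BoundedArithSyntax
import Literature.Computability.MetaComplexity.BoundedArithTheories

/-!
Route: RootDecompEfProver

DORMANT since 2026-09-04T13:17:51Z (reconciler: no traction for 5 d (last activity statement-checked at 2026-08-30T12:29:05Z); parked, not closed — `ledger route dormant route-PneNP-RootDecompEfProver --off` to reactivate) — unstaffed, not closed; items shared with open routes are served there. `ledger route dormant <id> --off` reactivates.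

# Route RootDecompEfProver — Root decomposition N1 (axis certificate): the EF-prover split of P ≠ NP

ROOT DECOMPOSITION CELL decomp-pnenp (D-0178; doctrine D-0170/0171/0172), gen 0, NODE N1 = lens-5
«EfProverSplit v1»
(proof-complexity axis), typed by the route-writer decomp-pnenp-writer-1 from the lens package
verbatim (statements, glue);
REV 1 (gen 2, 2026-08-30): lens-5 v2 «EfProverLadder» (HOME/decomp-pnenp-lens-5/EfProverLadder.lean
sha256
f6530d9e88ced951b082326bf6dd5d1f354f7bec425e812e397b3d8a533ef687; tree-landable companion
RootDecompEfProverLadder.lean sha256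
06f8f710197d9622f289fb516b23bcd4b5bcfbd87b44c62a2c045a0ec99cbdb2), critic CLEARED
2026-08-30T01:49:02Z (HOME/STATUS.md; CRITIC-LEDGER row «lens-5
EfProverLadder v2»): SAME node, pieces and tags UNCHANGED; adds (i) EF soundness PROVED in-file ⇒
the root equivalence is HYPOTHESIS-FREE,
(ii) the SYSTEM LADDER under A with its bottom rungs DECIDED IN KERNEL (record items RungFrege,
RungDepthDecided below), (iii) residual-type
identities for both pieces.
It suffices to show X = A ∧ B, and X is EQUIVALENT to S = P ≠ NP (kernel `node_iff`, HYPOTHESIS-FREE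
since v2 — EfProverLadder.lean:517, efSoundness = Cook–Reckhow Prop. 4.2 proved from
Frege.lean primitives; v1 cell file
run/shared/lean/pub/decomp-pnenp/decomp-pnenp-lens-5/EfProverSplit.lean sha256
703014f5a613c298be19098590b7889da480daca4c1a80105758746e20e76219 had it modulo EFSoundness): A =
NoFPProverEF — for every Frege rule list F no polynomial-time g maps every tautology to an
EF-certificate accepted by the proved polynomial-time EF checker chkFn F ("EF is not a
polynomial-time prover"); B = CollapseReachesEF —
the hub item stmt-PneNP-17354 verbatim (P = NP ⇒ some EF is polynomially bounded). NODE KIND: AND,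
exact, EQUIV-free; with X₀ := «some EF_F
has polynomially bounded chkFn-certificates» the node is the HORN NORMAL FORM S ⟺ (X₀ → S) ∧ (¬X₀' →
S) along the one open bit pb(EF)
(critic probe critic/L5_EfProverSplit_v1_probe.lean sha256
ffa511195a56dce947e67871e3874780d82a618fbcfd0ded1d8e7e347db2d784, horn_normal_form),
i.e. BOTH pieces are declared residuals = a case split on pb(EF) (critic w3), filed as
RESIDUAL(pbCerts(EF)) ∧ RESIDUAL(¬pb(EF)).
PIECE TAGS (critic CLEARED 2026-08-30T00:44:49Z, HOME/CRITIC-LEDGER.md row 2 — «CLEARED as AXIS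
CERTIFICATE; DOCTRINE FLAG 0 attackable pieces
(not a scoring root node, gen 0)»): A NoFPProverEF — WEAKER(formal: S ⟹ A kernel
noFPProverEF_of_pneNP; A ⟹ S open = Pich–Santhanam OP1 direction)
= DECLARED-RESIDUAL(X₀) = RESIDUAL-TYPE (pb⁺(EF) → S, kernel noFPProverEF_iff_residual) ·
NECESSARY(a,b) · not COSTUME · not LAW-A · leaf IDEA-NEEDED;
B CollapseReachesEF — DECLARED-RESIDUAL(EFLowerBound) of record (kernel
collapseReachesEF_iff_residual) = hub stmt-PneNP-17354 verbatim (Iff.rfl) ·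
WEAKER-by-logic · leaf IDEA-NEEDED. SYSTEM LADDER UNDER A (v2, critic w1 answered; LADDER VERDICT
01:49:02Z, probe
critic/L5_EfProverLadder_v2_probe.lean sha256 ac7a1417: every rung R_Q ⟺ (pb⁺(Q) → S) ⟺ S ∨ ¬pb⁺(Q)
— the LENGTH ladder ∨ S, g0's Horn reading one
level down; rungs S-implied (NEC), not COSTUME, not LAW-A; a rung is DECIDED exactly where its
antecedent is refuted by a length lower bound):
A = RungEF [OPEN·IDEA-NEEDED] ⟹ RungFrege [record item, aside; OPEN·IDEA-NEEDED; roads: Frege length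
lower bound = hub stmt-PneNP-0043 /
stmt-PneNP-0112 (INCOMPARABLE, cited by name), non-automatability only under Blum-factoring hardness
(BPR00, COSTUME-side)] ⟹ RungDepthFn δ
[certificates decoding to textbook-Frege proofs at most δ(|φ|) deeper than the target; DECIDED IN
PRINT for δ(s) ≤ log s/(59 log log s)
(Håstad TR17-142 Thm 6.5/Cor 6.6, Tseitin grids; kernel port = months, calibration only) · OPEN
above · IDEA-NEEDED·CALIBRATED (critic retag:
no kit instrument; PHP/Tseitin have poly-size O(log s)-depth proofs, Buss 1987, so the window needs
a NEW hard family) · PRECISION P1: the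
window is FINITE ABOVE — RungDepthFn(C·log s) ⟺ RungFrege for C large (p-time proof balancing), so
the ladder has exactly ONE open window
δ ∈ (log s/59 log log s, C log s) whose top IS the Frege rung] ⟹ RungDepth d [record item
RungDepthDecided, aside; DECIDED IN KERNEL for
every constant d: rungDepth_decided (Ajtai/KPW/PBI via the tree's hypothesis-free
boundedDepthFrege_pigeonhole_lowerBound_holds on PHP^{n+1}_n +
length_encode_pigeonholeForm_le + exists_poly_length_le_of_mem_FP) = CALIBRATION + the BC5 WITNESS
of weakness for crux NoFPProverEF
(writer file bc/N1_NoFPProverEF_rung.lean::rungDepthDecided_holds, rc 0, 0 sorry, axioms standard;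
attached on stmt-PneNP-23777)]; untyped
middle rungs AC⁰[p]- /TC⁰-Frege cited by name only (tree def AC0pFregeIsPolyBounded, hub
stmt-PneNP-11444). Leaves after v2:
ATTACKABLE-toward-S 0 / CALIBRATION-KERNEL 1 (RungDepth, done) / INSTRUMENTABLE 0 / IDEA-NEEDED 3
(RungFrege window, A, B) / BARRIER 0
(RR-style barrier for Frege lower bounds not catalogued; KP98/BPR00 feasible-interpolation barrier
noted). Residual NOT moved by v2 ⇒ no
score change (critic).
INSTRUMENT DATA: census/COSTUME-CENSUS-v1.json sha256
c3edddb4706a328d44a5e0d24af1b9951612412f3319dff241290bec3760c9a9 (.md sha256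
ca5b9db7c1a77f53851c4527da7ebb1687b4f3c67d5a358def525dbcd5c03f30), §2 law-D shape. WHY THIS IS
NOVEL: the four hub routes pair 17354 with a second
conjunct INCOMPARABLE with S (EFLowerBound 10743, EFNotPOptimal 18942, HardnessTransfer 18211,
AC-lines 19641–3); this node replaces it by the
kernel-certified WEAKEST complement A (universal property weakest_complement), so for the first time
both halves of the EF pincer are S-implied and
the axis is certified to contribute exactly the bit pb(EF). Rung currency: LADDER rung 0 (nothing
here proves P ≠ NP).
Lean: `(∀ F : Literature.Computability.MetaComplexity.FregeSystem,
Literature.Computability.MetaComplexity.IsFrege F → ¬ ∃ g ∈ Literature.Computability.Complexity.FP,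
∀ φ : Literature.Computability.Complexity.PropForm ℕ, φ.IsTautology →
Summit.PneNP.PneNP.Theorems.EFProofSearch.chkFn F (Literature.Computability.Complexity.boolPair
(Literature.Computability.Complexity.encodingPropForm.encode φ) (g
(Literature.Computability.Complexity.encodingPropForm.encode φ))) = [true]) ∧ (¬ PneNP → ∃ F :
Literature.Computability.MetaComplexity.FregeSystem, Literature.Computability.MetaComplexity.IsFrege
F ∧ F.IsEFPolyBounded)`

## Assembly
Search-to-decision: assume ¬ PneNP; B gives a Frege F with EF_F polynomially bounded; complete_chkFn
turns that into
polynomial-length chkFn-certificates; NP ⊆ P (model bridges np_bool_eq / p_bool_eq) and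
exists_searchFn_of_NP_subset_P give a
polynomial-time certificate finder, contradicting A at F. The deciding theorem `closes` in glue.lean
is exactly this (8 lines,
hypothesis-free; both binders load-bearing).

Rationale: WHY THIS LINE. On the proof-complexity axis every statement necessary for S = P ≠ NP has the form S
∨ (¬)pb(Q) for a Cook–Reckhow system Q
(kernel in the lens file: noFPProver_iff, collapseBounds_iff, weakest_complement): the axis
contributes exactly one bit, the
proof-length coordinate of a strong system, and the only live placement is Q = EF, where pb is open
both ways (Pich–Santhanam,
arXiv:2312.08163, conjecture P = NP ⇒ pb(EF); Open Problem 1 = the converse of B); at systems with a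
proved length lower bound
(AC⁰_d-Frege, boundedDepthFrege_pigeonhole_lowerBound_holds) the split degenerates (A a theorem, B ⟺
S: degenerate_of_lengthLowerBound).
The four hub routes (FeasibleWitnessing, EfNotPOptimal, FreeHardnessEF, FregeLinesACUniverse) pair
17354 with a second conjunct
incomparable with S; this node replaces it by the weakest complement A, which each of them implies
(18942 → A in kernel,
noFPProverEF_of_efNotPOptimal), turning the pincer into an equivalence with both halves S-implied.
Imported: search-to-decision
(AroraBarak2009 Thm 2.18, tree exists_searchFn_of_NP_subset_P), Cook–Levin for TAUT (tree), the EF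
certificate checker of route
EfNotPOptimal (tree, Theorems.EFProofSearch). Workshop honesty line (critic): this is the census §2
law-D shape made kernel-explicit,
an AXIS CERTIFICATE with 0 attackable leaves, not the scoring node of gen 0; critic w1 (a typed
system-ladder rung A_Q under A with a
prover-monotonicity proof) is ANSWERED by rev 1 (lens-5 v2 EfProverLadder, CLEARED
2026-08-30T01:49:02Z): the ladder HasFPProverWith F Q
(antitone in Q) RungEF = A ⟹ RungFrege ⟹ RungDepthFn δ ⟹ RungDepth d is typed, linearly ordered in
kernel, and its constant-depth rungs are
DECIDED in kernel (rungDepth_decided) — a special case of A decided where S and A are open; it does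
not move the residual (no score change).

RANKED CRUXES. #2 NoFPProverEF (crux) — PIECE A · tag WEAKER(formal; S ⟹ A kernel
noFPProverEF_of_pneNP in the lens file sha256 703014f5…; A ⟹ S open) = DECLARED-RESIDUAL(X₀), X₀ :=
some Frege F has polynomially bounded chkFn-certificates, i.e. A ⟺ P ≠ NP ∨ ¬X₀ ⟺ (X₀ → P ≠ NP)
(kernel noFPProverEF_iff) · leaf IDEA-NEEDED (roads: S; EF certificate-length lower bound ≈
stmt-PneNP-10743; KP89 non-p-optimality stmt-PneNP-18942 ⟹ A kernel) · critic CLEARED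
2026-08-30T00:44:49Z CRITIC-LEDGER row 2 — for every Frege rule list F (sound, implicationally
complete) there is no polynomial-time g mapping the code of every tautology φ to an EF-certificate
accepted by chkFn F: EF is not a polynomial-time prover. [difficulty: open-problem] (why it might
fail: false only if P = NP and some EF is p-bounded (then search-to-decision gives the prover); no
standard hypothesis yields that, but unconditionally A = S ∨ EF-certificate lower bound, two open
problems (or KP89 non-p-optimality).) [arXiv:2312.08163, KrajicekPudlak1989, Krajicek2019,
CookReckhow1979]
#3 CollapseReachesEF (crux) — PIECE B · tag DECLARED-RESIDUAL(EFLowerBound) (kernel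
collapseReachesEF_iff: B ⟺ ((∀ Frege F, ¬ IsEFPolyBounded F) → P ≠ NP)) · WEAKER-by-logic (S ⟹ B
vacuous, collapseReachesEF_of_pneNP; B ⟸ ¬pb(EF) → S open) · hub item stmt-PneNP-17354 VERBATIM
(collapseReachesEF_iff_hub : Iff.rfl) · leaf IDEA-NEEDED (registered line
Cruxes/CollapseReachesEF/Lines/birth.lean, stubs stub_uniformSolverOfCollapse /
stub_provableWitnessing / stub_cor20_2 — cited, not re-typed) · critic CLEARED 2026-08-30T00:44:49Z
CRITIC-LEDGER row 2 · tribunal filing residual: CollapseReachesEF — if P = NP then some Frege system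
has polynomially bounded extended-Frege proofs (any superpolynomial EF lower bound separates P from
NP; Pich–Santhanam Open Problem 1 via S¹₂-provable feasible witnessing). [difficulty: open-problem]
(why it might fail: the collapse may reach only EF + witnessing axioms w_n^k(f), not EF itself (PS23
§1.1.1); S¹₂-provability of uniform witnessing is open and any proof is non-relativizing.)
[arXiv:2312.08163, arXiv:2405.02232, Krajicek2019]
#9 RungFrege (support) — RECORD RUNG (kind aside at filing; never staffed; rev 1, lens-5 v2
WRITER-NOTE sha256 554fc0be…, critic CLEARED 2026-08-30T01:49:02Z): the FREGE RUNG of the system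
ladder under A — no Frege rule list F is a polynomial-time prover via chkFn-certificates that DECODE
(extractProof) to plain F-proofs (no extension axioms); S-implied (A ⟹ it: prover monotonicity,
kernel rungFrege_of_rungEF / writer rungFregeItem_of_noFPProverEF) · ⟺ (pb⁺(Frege) → S) · OPEN ·
IDEA-NEEDED · top of the one open depth window (P1); length road = a superpolynomial Frege lower
bound = hub items stmt-PneNP-0043 / stmt-PneNP-0112 (cited by name, not re-typed; INCOMPARABLE with
S). [CookReckhow1979, Krajicek1995, BonetPitassiRaz2000]
#9 RungDepthDecided (support) — RECORD RUNG (kind aside at filing; never staffed; DECIDED IN KERNEL;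
the BC5 WITNESS for NoFPProverEF): for every d, textbook Frege is not a polynomial-time prover via
certificates decoding to proofs whose lines are at most d deeper (altDepth) than the target — on
PHP^{n+1}_n (depth ≤ 4, code length poly(n)) the decoded proof would have polynomial size,
contradicting the tree's hypothesis-free Ajtai/KPW/PBI theorem
boundedDepthFrege_pigeonhole_lowerBound_holds; proved as rungDepth_decided (lens-5 companion sha256
06f8f710…) = writer bc/N1_NoFPProverEF_rung.lean::rungDepthDecided_holds (rc 0, 0 sorry, axioms
propext/Classical.choice/Quot.sound); depth is RELATIVE to the target on purpose (absolute-depth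
rungs are vacuous). [Ajtai1988, KrajicekPudlakWoods1995, PitassiBeameImpagliazzo1993]

TWO-LAYER PLAN. A ⇐ (EF certificate-length lower bound for every Frege F) — kernel
noFPProver_of_not_hasPolyBoundedCerts; A ⇐ EFNotPOptimal
(stmt-PneNP-18942) — kernel noFPProverEF_of_efNotPOptimal; A ⇐ PneNP. The system ladder under A
(critic w1) is TYPED in rev 1 as record
rungs, not as a split of A (no rung implies A; they are consequences): RungEF = A ⟹ RungFrege
(aside) ⟹ RungDepthFn δ (lens def; decided in
print up to δ = log s/59 log log s, Håstad 2017; equivalent to RungFrege from δ = C log s on, P1) ⟹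
RungDepth d (aside RungDepthDecided, DECIDED
in kernel ∀ d); length road of any rung: noFPProverWith_of_not_hasPolyBoundedCertsWith /
noFPProverWith_of_sizeLowerBound (lens companion);
AC⁰[p]- /TC⁰-Frege rungs stay untyped (no certificate checker over PropFormMod in the tree; length
versions AC0pFregeIsPolyBounded,
stmt-PneNP-11444 cited by name). B keeps its registered line
Cruxes/CollapseReachesEF/Lines/birth.lean (stub_uniformSolverOfCollapse /
stub_provableWitnessing / stub_cor20_2). AUDIT CAVEAT (lens, endorsed by the critic):
noFPProverEF_of_pneNP, collapseReachesEF_of_pneNP,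
noFPProverEF_of_efNotPOptimal are implications INTO items under hypotheses, not item proofs — never
to be landed as closing proofs.

KILL CRITERIA. A theorem ¬NoFPProverEF would prove P = NP together with pb(EF) — it closes the route
refuted:NoFPProverEF and decides the summit
negatively along the way; a refutation of CollapseReachesEF (P = NP yet no EF p-bounded) breaks this
route together with the four
hub routes. If EFLowerBound (10743) or EFNotPOptimal (18942) is proved, A follows and the route
reduces to B alone (= PS-OP1).

NOT DECOMPOSED YET. The S¹₂-provability layer under B (PS Cor. 20(2), KPS26 Condition 2) is not
typable in the tree (no bounded-arithmetic
provability predicate); the system-ladder rungs A_Q under A need certificate languages for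
AC⁰[p]- /TC⁰-Frege (not in the tree); the
raw-proof form of A (NoFPProverEFRaw, kernel → A) and the EFLowerBound → A implication (print; the
tree's IsEFPolyBounded measures
proofSize against φ.size, certificates against |encode φ|) stay un-filed record.

CHEAPEST FALSIFIER. Lookup, run: does any registered strong hypothesis
(Literature/StrongHypotheses/PneNP.lean) refute A or B? None: A and B are both
implied by PneNP (kernel), so only P = NP-type hypotheses bear on them, and none is registered.
In-Lean: the abstract degeneration
lemma degenerate_of_lengthLowerBound shows the split carries no transfer at systems with proved
lower bounds (AC⁰_d-Frege:
boundedDepthFrege_pigeonhole_lowerBound_holds) — the reason the node sits at EF.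

NUMBERS. BC9 (ladder, lens-5 v2 + critic): method_family = restriction / switching lemma /
k-evaluations (Ajtai, KPW95, PBI93, Håstad 2017);
ladder_ceiling = capped at proof-line depth Θ(log s / log log s) above the target (decided: every
constant d in kernel; δ ≤ log s/(59 log log s)
in print [galaxy:pdf:-1819710331930726460 pp.19–20]); ceiling_lift = a lower-bound technique for
unbounded-depth Frege on a NEW hard family
(PHP/Tseitin have poly-size O(log s)-depth Frege proofs, Buss 1987) = exactly RungFrege / A,
declared OPEN·IDEA-NEEDED, not claimed;
ceiling_sources = [Literature.Computability.Complexity.ProofComplexityPHPLowerBound (tree,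
hyp-free), galaxy:pdf:-1819710331930726460,
Literature.Barriers.PneNP.FeasibleInterpolationEF]. Rung in hand on the length road: depth-d Frege
proofs of PHP^{n+1}_n need size 2^{n^{ε_d}} (boundedDepthFrege_pigeonhole_lowerBound_holds;
Theorems.noPolyBoundedProofSystem_pigeonholeRung), Frege proves PHP in size n^{O(log n)} (tree, weak
Buss 1987); nothing superlinear
is known for Frege/EF size. Leaf counts of this node: ATTACKABLE 0, INSTRUMENTABLE 0, IDEA-NEEDED 2,
BARRIER 0.

DEFINITION REQUESTS. None filed. (Record: a bounded-arithmetic provability predicate S¹₂ ⊢ would let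
B's printed sub-split be typed; certificate
languages for AC⁰[p]-Frege / TC⁰-Frege would let the w1 rungs under A be typed.)

Novelty: Searches (2026-08-30, run by lens-5 and adopted; the writer re-ran the tree scan and the negatives
index): lit search --hybrid "P = NP implies extended Frege polynomially bounded feasible witnessing"
(PS23 arXiv:2312.08163 held, JACM doi:10.1145/3801091; AKPS24 arXiv:2405.02232 held); lit search
"automatability resolution NP-hard Atserias Muller" (AM19/AM20); route-census notes reader 58/59 for
FeasibleWitnessing, EfNotPOptimal (VERDICTS.tsv); ledger negatives --problem PneNP (6 entries, none
on proof systems; writer re-run 2026-08-30T00:5xZ); rg over lean/Summits/PneNP and lean/Literature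
for HasFPProver|NoFPProver|FPProver (0 files: piece A is new on the hub; only
EFProofSearchOfCollapse 18943 is the ∃-form under collapse).
Nearest prior art found: route-PneNP-EfNotPOptimal (closes from 17354 ∧ EFNotPOptimal ∧ 18943) and
Pich–Santhanam arXiv:2312.08163 §1 (the pincer "EF lower bound + feasible witnessing ⇒ P ≠ NP").
Delta: the second conjunct is replaced by the weakest complement of the hub item (kernel universal
property), making the node an equivalence with both pieces S-implied and certifying that the axis
contributes exactly the bit pb(EF).
Claimed grade: new-combination  [refs: 10.1145/3801091, 2312.08163, 2405.02232, doi:10.1145/3801091]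

Barriers (technique_class: proof-complexity, search-to-decision, cook-reckhow): - technique_class: proof-complexity, search-to-decision, cook-reckhow
- Literature.Barriers.PneNP.Relativization: A and B are S-implied statements about one explicit
verifier with no oracle slot; BGS prices only the S-road to A and says nothing about B's only known
road (S¹₂-provable witnessing = local checkability, non-relativizing by construction); the bet is
that the non-relativizing content sits in B. Neither piece is BARRIER-excluded on its axis (critic
row 2).
- Literature.Barriers.PneNP.NaturalProofs: no piece is a circuit lower bound; RR prices only the
S-road to A; the length road to A (EF lower bounds) has no natural-proofs analogue for proof systems
(Pudlák), so it does not; the bet is the length/KP89 roads or B.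
- Literature.Barriers.PneNP.Algebrization: AW quantifies over algebrizing separations/inclusions of
classes; A and B are statements about one explicit proof checker under a collapse, outside its scope
except along the S-road; it does not bite the node's own content.
- Literature.Barriers.PneNP.FeasibleInterpolationEF: bites the interpolation sub-road of the
EF-length road to A (KP98: EF has no feasible interpolation unless RSA is insecure); the length road
must be a non-interpolation EF argument, or A comes via KP89 non-p-optimality or via S.
- Literature.Barriers.PneNP.RelativizedCircuitSize: no piece is a circuit lower bound (B even
consumes P = NP ⇒ small SAT circuits); it does not apply.
- Negatives index: empty at filing for proof-system statements (6

History (route lifecycle, newest last):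
- 2026-09-04T13:17:51Z · DORMANT — reconciler: no traction for 5 d (last activity statement-checked at 2026-08-30T12:29:05Z); parked, not closed — `ledger route dormant route-PneNP-RootDecompEfPr (operator:999:3339964)

sub-problem: PneNP · status: dormant · opened planner-decomp-pnenp-writer-1-g0-0 2026-08-30T01:11:25Z · rev 4 · ledger route-PneNP-RootDecompEfProver
GENERATED by the gate from the ledger (D-0016/17). Provers cite these decls: `theorem foo : Summit.PneNP.PneNP.Theses.RootDecompEfProver.<Decl> := …` in Summits/PneNP/PneNP/Theorems/<Name>.lean.
-/

namespace Summit.PneNP.PneNP.Theses.RootDecompEfProver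

open scoped BigOperators Topology Manifold Classical MeasureTheory ProbabilityTheory Matrix InnerProductSpace ComplexConjugate ContinuousMap
open Filter Set Function TopologicalSpace MeasureTheory

attribute [summit_statement] _root_.PneNP

open Literature.PNP

/-- item stmt-PneNP-23777 · crux · rank 2 · SPLIT (gen 1) into NoS12ProofOfNPeqCoNP, ProverIsProvable + glue NoFPProverEFGlue · direct attempts still welcome (low priority) · by planner
why it might fail: false only if P = NP and some EF is p-bounded (then search-to-decision gives the prover); no standard hypothesis yields that, but unconditionally A = S ∨ EF-certificate lower bound, two open problems (or KP89 non-p-optimality).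
sources: arXiv:2312.08163, KrajicekPudlak1989, Krajicek2019, CookReckhow1979
[crux] PIECE A · tag WEAKER(formal; S ⟹ A kernel noFPProverEF_of_pneNP in the lens file sha256
703014f5…; A ⟹ S open) = DECLARED-RESIDUAL(X₀), X₀ := some Frege F has polynomially bounded
chkFn-certificates, i.e. A ⟺ P ≠ NP ∨ ¬X₀ ⟺ (X₀ → P ≠ NP) (kernel noFPProverEF_iff) · leaf
IDEA-NEEDED (roads: S; EF certificate-length lower bound ≈ stmt-PneNP-10743; KP89 non-p-optimality
stmt-PneNP-18942 ⟹ A kernel) · critic CLEARED 2026-08-30T00:44:49Z CRITIC-LEDGER row 2 — for every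
Frege rule list F (sound, implicationally complete) there is no polynomial-time g mapping the code
of every tautology φ to an EF-certificate accepted by chkFn F: EF is not a polynomial-time prover.
[difficulty: open-problem] -/
@[route_item "route-PneNP-RootDecompEfProver"]
def NoFPProverEF : Prop :=
  ∀ F : Literature.Computability.MetaComplexity.FregeSystem, Literature.Computability.MetaComplexity.IsFrege F → ¬ ∃ g ∈ Literature.Computability.Complexity.FP, ∀ φ : Literature.Computability.Complexity.PropForm ℕ, φ.IsTautology → Summit.PneNP.PneNP.Theorems.EFProofSearch.chkFn F (Literature.Computability.Complexity.boolPair (Literature.Computability.Complexity.encodingPropForm.encode φ) (g (Literature.Computability.Complexity.encodingPropForm.encode φ))) = [true]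

-- parent: NoFPProverEF · child (gen 1)
/--     item stmt-PneNP-26831 · crux · rank 201 · open
    parent: NoFPProverEF · by planner
    why it might fail: False iff S₂¹ ⊢ NP = coNP (every Πᵇ₁ formula S₂¹-provably Σᵇ₁); by Cor 15.3.8 that needs P = NP via an S₂¹-certified algorithm — nothing known excludes it, and 30 years of forcing built only relativised/conditional models (KPT91, CK07, KO17, BKO20).
    sources: Krajicek1995, Krajicek2019, Buss1986, arXiv:1605.00263, arXiv:1905.12935
[crux] PROVABILITY RUNG U under piece A = NoFPProverEF (lens-5 g3 «EfProvabilityRung»,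
HOME/decomp-pnenp-lens-5/EfProvabilityRung.lean sha256
4810ea0d5470e5a732309fb61c8a12a082c3e86ae9b437427e87fb59626341ee l.1011–1013 VERBATIM — writer cert
bc/N1v3_items.lean: item_iff_lens = Iff.rfl, lean check rc 0 / 0 sorry, BC7 #h21_crux_probe VERDICT
CLEAN; critic CLEARED 2026-08-30T03:25:15Z (CRITIC-LEDGER row «lens-5 EfProvabilityRung g3», probe
critic/L5_EfProvabilityRung_g3_probe.lean sha256 562e78c8…) + amendment a1: lens-6 g3
«ProvabilityDial» N8 MERGED HERE — DarkForS12 ≡ U in print (Krajíček 1995 Thm 15.3.7 (i)⟺(ii)), ONE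
provability item for the cell): «S₂¹ does not prove NP = coNP» — some Πᵇ₁ bounded formula ψ has NO
Σᵇ₁ formula χ with S₂¹ ⊨ᵇ (ψ ⇔ χ) (Mathlib semantic consequence, free variables universal; over the
built tree modules BoundedArithSyntax/BoundedArithTheories) = Krajíček's FUNDAMENTAL PROBLEM §15.3,
simplest case «is there a model of S₂¹ / PV in which NP ≠ coNP?» (⟺ S₂¹ ⊬ P = NP ⟺ S₂¹ ⊬ «EF is
complete», Thm 15.3.7). TAGS: WEAKER (S ⟹ U = Krajíček Cor 15.3.8 p.272; KERNEL modulo two named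
print facts h1 BussNPcoNP = Cor 7.2.5 «provably NP ∩ coNP is P», h2 SigmabOneDefi -/
@[route_item "route-PneNP-RootDecompEfProver"]
def NoS12ProofOfNPeqCoNP : Prop :=
  ∃ (k : ℕ) (ψ : FirstOrder.Language.boundedArith.Formula (Fin k)), Literature.Computability.MetaComplexity.IsPib 1 ψ ∧ ∀ χ : FirstOrder.Language.boundedArith.Formula (Fin k), Literature.Computability.MetaComplexity.IsSigmab 1 χ → ¬ (Literature.Computability.MetaComplexity.S2 1 ⊨ᵇ FirstOrder.Language.BoundedFormula.iff ψ χ)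

-- parent: NoFPProverEF · child (gen 1)
/--     item stmt-PneNP-26832 · crux · rank 202 · open
    parent: NoFPProverEF · by planner
    why it might fail: P = NP might hold only via algorithms whose correctness S₂¹ cannot prove: then U holds, A fails and U → A is false; no lifting theorem «p-time EF-prover ⟹ S₂¹ ⊢ NP = coNP» (converse of Thm 15.3.7 + witnessing) is known or expected from current technique.
    sources: Krajicek1995, Krajicek2019, arXiv:2312.08163
[crux] DECLARED RESIDUAL of the A-side (lens-5 g3 EfProvabilityRung.lean l.1076 verbatim; critic
CLEARED 2026-08-30T03:25:15Z, amendment a3: N1 now carries TWO declared residuals — this one and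
CollapseReachesEF; their conjunction is lens-6's S12Lift / CertificationLift in kernel given N1's
facts, record only): U → A, i.e. «if S₂¹ ⊬ NP = coNP then no Frege rule list F admits a
polynomial-time EF-prover (chkFn-certificates for all tautologies)»; contrapositive = PROVABILITY
LIFTING «a polynomial-time EF-prover ⟹ S₂¹ ⊢ NP = coNP» (a true collapse witnessed by a prover would
be S₂¹-provable). TAGS: S-implied (kernel proverIsProvable_of_pneNP in the lens file; A ⟹ it
trivially, writer proverIsProvableItem_of_noFPProverEF) · strictly WEAKER than A while U is open ·
UNDECIDED · IDEA-NEEDED · RESIDUAL-TYPE (a consequence of S used toward S only together with U: A ⟺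
U ∧ (U → A), kernel noFPProverEF_iff_split / writer noFPProverEF_iff_children; node v3 S ⟺ U ∧ (U →
A) ∧ B, node3_iff' mod h1,h2) · staffing LOW (residual; tribunal filing residual: ProverIsProvable,
CollapseReachesEF) · BC7 #h21_crux_probe VERDICT CLEAN (writer bc/N1v3_items.lean). No lifting
theorem of this shape is in print -/
@[route_item "route-PneNP-RootDecompEfProver"]
def ProverIsProvable : Prop :=
  NoS12ProofOfNPeqCoNP → NoFPProverEF

-- parent: NoFPProverEF · glue (gen 1)
/--     item stmt-PneNP-26833 · support · rank 203 · closed · proved by Summit.PneNP.PneNP.Theorems.noFPProverEFGlue_proof (prover)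
    parent: NoFPProverEF · GLUE: children ⟹ parent · by planner
NoS12ProofOfNPeqCoNP → ProverIsProvable → NoFPProverEF (modus ponens; writer cert
bc/N1v3_items.lean::noFPProverEF_of_children; lens-5 g3 closes3) -/
@[route_item "route-PneNP-RootDecompEfProver"]
def NoFPProverEFGlue : Prop :=
  NoS12ProofOfNPeqCoNP → ProverIsProvable → NoFPProverEF

-- `NoFPProverEFGlue` holds: proved by `Summit.PneNP.PneNP.Theorems.noFPProverEFGlue_proof` (its module imports this route file, so no `_holds` link can be stated here).

/-- item stmt-PneNP-17354 · crux · rank 3 · open · by planner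
why it might fail: the collapse may reach only EF + witnessing axioms w_n^k(f), not EF itself (PS23 §1.1.1); S¹₂-provability of uniform witnessing is open and any proof is non-relativizing.
sources: arXiv:2312.08163, arXiv:2405.02232, Krajicek2019
[crux] if P = NP (¬PneNP) then some — equivalently every — Frege system has polynomially bounded
extended Frege proofs: "any superpolynomial EF lower bound separates P and NP" (Pich–Santhanam Open
Problem 1), to be obtained from S¹₂-provable uniform witnessing of errors of n^k-time SAT algorithms
(Cor. 20(2)) or APC₁-provable anticheckers (§1.3.1; KPS26 Condition 2). [difficulty: open-problem] -/
@[route_item "route-PneNP-RootDecompEfProver"]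
def CollapseReachesEF : Prop :=
  ¬ PneNP → ∃ F : Literature.Computability.MetaComplexity.FregeSystem, Literature.Computability.MetaComplexity.IsFrege F ∧ F.IsEFPolyBounded

/-- item stmt-PneNP-24567 · aside · rank 9 · open · by planner
sources: CookReckhow1979, Krajicek1995, BonetPitassiRaz2000
[support] RECORD RUNG (kind aside at filing; never staffed; rev 1, lens-5 v2 EfProverLadder,
WRITER-NOTE-v2 sha256 554fc0be…, critic CLEARED 2026-08-30T01:49:02Z): the FREGE RUNG of the system
ladder under A — no Frege rule list F is a polynomial-time prover via chkFn-certificates that DECODE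
(extractProof) to plain F-proofs (no extension axioms); S-implied (A ⟹ it by prover monotonicity,
kernel rungFrege_of_rungEF in the lens companion sha256 06f8f710… / writer
bc/N1_NoFPProverEF_rung.lean::rungFregeItem_of_noFPProverEF) · ⟺ (pb⁺(Frege) → S) (critic ladder
verdict) · OPEN · IDEA-NEEDED · top of the ONE open depth window δ ∈ (log s/59 log log s, C log s)
(P1: RungDepthFn(C log s) ⟺ RungFrege by proof balancing); length road = a superpolynomial Frege
lower bound = hub items stmt-PneNP-0043 / stmt-PneNP-0112 (cited by name, not re-typed; INCOMPARABLE
with S). -/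
@[route_item "route-PneNP-RootDecompEfProver"]
def RungFrege : Prop :=
  ∀ F : Literature.Computability.MetaComplexity.FregeSystem, Literature.Computability.MetaComplexity.IsFrege F → ¬ ∃ g ∈ Literature.Computability.Complexity.FP, ∀ φ : Literature.Computability.Complexity.PropForm ℕ, φ.IsTautology → (Summit.PneNP.PneNP.Theorems.EFProofSearch.chkFn F (Literature.Computability.Complexity.boolPair (Literature.Computability.Complexity.encodingPropForm.encode φ) (g (Literature.Computability.Complexity.encodingPropForm.encode φ))) = [true] ∧ F.IsProofOf (Summit.PneNP.PneNP.Theorems.EFProofSearch.extractProof (Literature.Computability.Complexity.encodingPropForm.encode φ) (g (Literature.Computability.Complexity.encodingPropForm.encode φ))) φ)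

/-- item stmt-PneNP-24568 · aside · rank 9 · closed · proved by Summit.PneNP.PneNP.Theorems.rungDepthDecided_proof (prover) · by planner
sources: Ajtai1988, KrajicekPudlakWoods1995, PitassiBeameImpagliazzo1993, Buss1987
[support] RECORD RUNG (kind aside at filing; never staffed; DECIDED IN KERNEL — the BC5 WITNESS of
weakness for crux NoFPProverEF; rev 1, lens-5 v2, critic CLEARED 2026-08-30T01:49:02Z «CALIBRATION +
valid BC5 witness for T3-absent crux stmt-PneNP-23777»): for every d, textbook Frege is not a
polynomial-time prover via chkFn-certificates decoding to proofs whose lines are at most d deeper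
(altDepth) than the target — on PHP^{n+1}_n (depth ≤ 4, code length poly(n):
length_encode_pigeonholeForm_le) the decoded proof would have polynomial size
(exists_poly_proofSize_extractProof, exists_poly_length_le_of_mem_FP), contradicting the tree's
hypothesis-free Ajtai/KPW/PBI theorem boundedDepthFrege_pigeonhole_lowerBound_holds; PROVED:
rungDepth_decided (lens-5 companion RootDecompEfProverLadder.lean sha256 06f8f710…) = writer
bc/N1_NoFPProverEF_rung.lean::rungDepthDecided_holds (rc 0, 0 sorry, axioms
propext/Classical.choice/Quot.sound; attached as evidence on stmt-PneNP-23777); depth RELATIVE to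
the target on purpose (absolute-depth rungs are vacuous); A ⟹ RungFrege ⟹ this (kernel). A special
case of A decided where S and A are open, exercising the route's length lever (length lower bound -/
@[route_item "route-PneNP-RootDecompEfProver"]
def RungDepthDecided : Prop :=
  ∀ d : ℕ, ¬ ∃ g ∈ Literature.Computability.Complexity.FP, ∀ φ : Literature.Computability.Complexity.PropForm ℕ, φ.IsTautology → (Summit.PneNP.PneNP.Theorems.EFProofSearch.chkFn Literature.Computability.MetaComplexity.textbookFrege (Literature.Computability.Complexity.boolPair (Literature.Computability.Complexity.encodingPropForm.encode φ) (g (Literature.Computability.Complexity.encodingPropForm.encode φ))) = [true] ∧ Literature.Computability.MetaComplexity.textbookFrege.IsDepthProofOf (φ.altDepth + d) (Summit.PneNP.PneNP.Theorems.EFProofSearch.extractProof (Literature.Computability.Complexity.encodingPropForm.encode φ) (g (Literature.Computability.Complexity.encodingPropForm.encode φ))) φ)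

-- `RungDepthDecided` holds: proved by `Summit.PneNP.PneNP.Theorems.rungDepthDecided_proof` (its module imports this route file, so no `_holds` link can be stated here).

/-- item stmt-PneNP-23778 · assembly · rank 1 · open · by planner
sources: AroraBarak2009, CookReckhow1979
[assembly] NoFPProverEF → CollapseReachesEF → P ≠ NP (Target = ROOT statement `PneNP` ⟸ A ∧ B;
converse S ⟹ A ∧ B kernel in the lens file, node_iff). -/
@[route_item "route-PneNP-RootDecompEfProver"]
def Assembly : Prop :=
  NoFPProverEF → CollapseReachesEF → PneNP

/-! D-0027 §2.1 — DECIDING THEOREM (planner-authored via `route open/edit --closes-file`; by planner-decomp-pnenp-writer-1-g0-0 2026-08-30T01:11:25Z):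
its hypotheses are this route's items and its conclusion the sub-problem Statement (glue_lint), and it elaborates with this file. -/

@[closes "route-PneNP-RootDecompEfProver"] theorem closes (hA : NoFPProverEF) (hB : CollapseReachesEF) : PneNP := by
  by_contra hS
  obtain ⟨F, hF, hb⟩ := hB hS
  have hNP : Literature.Computability.Complexity.Nondeterministic.NP ⊆ Literature.Computability.Complexity.Classes.P :=
    fun A hA' => by
      by_contra hA''
      exact hS ⟨A, by rw [Literature.Computability.Complexity.CookBridges.np_bool_eq]; exact hA',
        by rw [Literature.Computability.Complexity.p_bool_eq]; exact hA''⟩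
  obtain ⟨q, hq⟩ := Summit.PneNP.PneNP.Theorems.EFProofSearch.complete_chkFn hb
  obtain ⟨g, hg, hspec⟩ := Literature.Computability.Complexity.exists_searchFn_of_NP_subset_P hNP
    (Summit.PneNP.PneNP.Theorems.EFProofSearch.chkLang_mem_P F) q
  exact hA F hF ⟨g, hg, fun φ hφ => (hspec _ (hq φ hφ)).2⟩

end Summit.PneNP.PneNP.Theses.RootDecompEfProver
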